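import Summits.BirchSwinnertonDyer.BirchSwinnertonDyer.Theorems.UniversalToricDescentThinCombNoPseudoNullOfPoitouTate
import Summits.BirchSwinnertonDyer.BirchSwinnertonDyer.Theorems.EisensteinPrimesPoitouTateShaNaturalAtTC
import HarnessLib

/-!
# Line `thin_comb` / `ratwall_thin_comb` (cruxes stmt-BirchSwinnertonDyer-20395 `AdditiveSplitIMCInclusionAtThree`,
# stmt-BirchSwinnertonDyer-24207 `RationalSplitIMCInclusionAtThree`, stmt-BirchSwinnertonDyer-20186): the support stub
# `stub_noPseudoNull` is now an UNCONDITIONAL tree theorem (helper, `--supports stmt-BirchSwinnertonDyer-24207`;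
# cell `pub/bsd-wall`, lead `cruxlead-24207` g2)

Up to this file `stub_noPseudoNull` (registered VERBATIM on line `thin_comb` v8.1 of the wall 20395; closed BY NAME inside the
skeletons `ratwall_thin_comb` v2/v3 of the rational wall 24207 from the CITE-ONLY stub `stub_printInputs`) was a theorem GRANTED ONE
textbook statement: the natural restricted Poitou–Tate `Ш`-duality at every finite set of places of a totally complex number field,
`∀ L [IsTotallyComplex L] S, S.Finite → GaloisCohomology.poitouTate_shaRestricted_tateDual_natural_at L S` (Milne ADT I Thm. 4.10 (a)),
via `…ThinComb.NoPseudoNullOfPoitouTate.stub_noPseudoNull_of_poitouTateAt` (lead `cruxlead-20395` g7). That statement is now PROVED in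
the kernel — the END theorem of the cell `bsd-eis` lane «PT-Ш-S-TC»,
`…Theorems.PoitouTateShaNaturalAtTC.forall_poitouTate_shaRestricted_tateDual_natural_at_of_isTotallyComplex` (p735406, 2026-08-29) — so
both the arena statement and the stub hold outright:

* `stub_printInputs` — the CITE-ONLY stub of `ratwall_thin_comb` v2/v3 (registered signature VERBATIM), by the END theorem (lands the stub);
* `xGr₂_hasNoPseudoNullSubmodule` — for `W/K` elliptic, `K` imaginary quadratic, `2 < p = v·v̄` split, ANY generator pair of
  `Gal(K̃_∞/K)`, `X_Gr₂ = X_{∅ at v, nr at v̄}(E/K̃_∞)` torsion over `Λ₂ = ℤ_p⟦T₁,T₂⟧` ⟹ it has no non-zero pseudo-null `Λ₂`-submodule;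
* `stub_noPseudoNull` — the registered signature of line `thin_comb` VERBATIM (p = 3, the wall's frame binders, unused), unconditional.

Consequences: the cite stub `stub_printInputs` of `ratwall_thin_comb` v3 closes BY NAME (skeleton v4 keeps only the two research stubs
K3a♯ `stub_toricExistsUpTo` and K2-rat⊕K4⊕K3(iii)♯ `stub_ratCombDivisibilityUpTo`); on 20395 the registered `stub_noPseudoNull` is
landed by this file's second theorem. HONEST FRAMING: Greenberg 2016 Props. 4.1.1 / 4.2.2, Greenberg 2006 §§4–6, Greenberg 2010
Prop. 3.2.1 (c), Tate's global Euler characteristic and Milne I 4.10 (a) / I 5.1 at totally complex fields all enter as TREE THEOREMS;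
nothing here is evidence for the research stubs; no summit statement, no case of BSD and neither crux is proved by this file.

References: [Greenberg2016Selmer] Prop. 4.1.1 (c) (§4.1 p. 15); [Greenberg2006] Props. 4.1, 4.2, §5 A, 6.10; [Greenberg2010] Prop. 3.2.1 (c);
[MilneADT2006] I Thm. 4.10 (a) (p. 57), I Thm. 5.1; [Harari2020] Thm. 17.13.
-/

set_option linter.dupNamespace false
set_option autoImplicit false
noncomputable section

open scoped Classical
open NumberField IsDedekindDomain Field
open Literature.NumberTheory.EllipticCurves Literature.NumberTheory.GaloisRepresentations
  Literature.NumberTheory.GaloisCohomology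
  Literature.NumberTheory.IwasawaTheory Literature.NumberTheory.IwasawaTheory.Greenberg2016

namespace Summit.BirchSwinnertonDyer.BirchSwinnertonDyer.Theorems.UniversalToricDescentThinComb.NoPseudoNull

/-- **The CITE-ONLY stub `stub_printInputs` of line `ratwall_thin_comb` v2/v3 (crux 24207; the registered signature VERBATIM) — now a THEOREM**:
Milne ADT I Thm. 4.10 (a) in the pointwise natural form, at every finite set of finite places of every totally complex number field, is the END
theorem of the cell `bsd-eis` lane «PT-Ш-S-TC», `PoitouTateShaNaturalAtTC.forall_poitouTate_shaRestricted_tateDual_natural_at_of_isTotallyComplex`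
(p735406). Landing it retires the cite stub (skeleton v4). [cite: MilneADT2006, I Thm. 4.10 (a) (p. 57)] [cite: Harari2020, Thm. 17.13 (b)] -/
theorem stub_printInputs : ∀ (L : Type) [Field L] [NumberField L] [IsTotallyComplex L] (S : Set (HeightOneSpectrum (𝓞 L))), S.Finite → Literature.NumberTheory.GaloisCohomology.poitouTate_shaRestricted_tateDual_natural_at L S :=
  Summit.BirchSwinnertonDyer.BirchSwinnertonDyer.Theorems.PoitouTateShaNaturalAtTC.forall_poitouTate_shaRestricted_tateDual_natural_at_of_isTotallyComplex

/-- **`X_Gr(E/K̃_∞)` has no non-zero pseudo-null `Λ₂`-submodule — UNCONDITIONAL** (`W/K` elliptic, `K` imaginary quadratic,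
`2 < p = v·v̄` split, any generator pair, `X_Gr₂` torsion): `…NoPseudoNullOfPoitouTate.xGr₂_hasNoPseudoNullSubmodule_of_poitouTateAt` fed
with the tree theorem `PoitouTateShaNaturalAtTC.forall_poitouTate_shaRestricted_tateDual_natural_at_of_isTotallyComplex` (Milne ADT I
Thm. 4.10 (a) at finite `S` of totally complex fields, proved in the kernel by the cell `bsd-eis`).
[cite: Greenberg2016Selmer, Prop. 4.1.1 (c) (§4.1 p. 15)] [cite: MilneADT2006, I Thm. 4.10 (a) (p. 57)] -/
theorem xGr₂_hasNoPseudoNullSubmodule {K : Type} [Field K] [NumberField K] {p : ℕ} [Fact p.Prime]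
    (W : WeierstrassCurve K) [W.IsElliptic] (κ₁ κ₂ : ZpExtension K p) (vbar : HeightOneSpectrum (𝓞 K))
    (γ₁ γ₂ : absoluteGaloisGroup K) [Fact (ZpExtension.IsTopGeneratorPair κ₁ κ₂ γ₁ γ₂)]
    (hp : 2 < p) (hK : IsImaginaryQuadratic K)
    {v : HeightOneSpectrum (𝓞 K)} (hv : ((p : ℕ) : 𝓞 K) ∈ v.asIdeal)
    (hvbar : ((p : ℕ) : 𝓞 K) ∈ vbar.asIdeal) (hne : vbar ≠ v)
    (htors : Module.IsTorsion (IwasawaAlgebra₂ p) (W.XGr₂ p κ₁ κ₂ vbar γ₁ γ₂)) :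
    HasNoPseudoNullSubmodule (IwasawaAlgebra₂ p) (W.XGr₂ p κ₁ κ₂ vbar γ₁ γ₂) :=
  NoPseudoNullOfPoitouTate.xGr₂_hasNoPseudoNullSubmodule_of_poitouTateAt W κ₁ κ₂ vbar γ₁ γ₂
    Summit.BirchSwinnertonDyer.BirchSwinnertonDyer.Theorems.PoitouTateShaNaturalAtTC.forall_poitouTate_shaRestricted_tateDual_natural_at_of_isTotallyComplex
    hp hK hv hvbar hne htors

/-- **`stub_noPseudoNull` of line `thin_comb` (crux 20395; the registered signature VERBATIM, also the v1 stub of `ratwall_thin_comb` on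
24207 / 20186) — UNCONDITIONAL.** At `p = 3 = 𝔭𝔭′` split in the imaginary quadratic `K`, in any generator pair, `X_{∅ at 𝔭, nr at 𝔭′}(E/K̃_∞)`
finitely generated and torsion over `Λ₂` ⟹ every pseudo-null `Λ₂`-submodule is finite:
`…NoPseudoNullOfPoitouTate.stub_noPseudoNull_of_poitouTateAt` fed with the tree theorem
`PoitouTateShaNaturalAtTC.forall_poitouTate_shaRestricted_tateDual_natural_at_of_isTotallyComplex`. The frame hypotheses are not used.
[cite: Greenberg2016Selmer, Prop. 4.1.1 (c) (§4.1 p. 15)] [cite: MilneADT2006, I Thm. 4.10 (a) (p. 57)] -/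
theorem stub_noPseudoNull :
    ∀ (W : WeierstrassCurve ℚ) [W.IsElliptic] [W.IsGloballyMinimal] (K : Type) [Field K] [NumberField K],
    Summit.BirchSwinnertonDyer.Rank1Residual.Additive.ClassO6 W 3 → W.HasSurjectiveModNGaloisRep 3 →
    IsImaginaryQuadratic K →
    ∀ (κ : ZpExtension K 3), κ.IsAnticyclotomic → ∀ (γ : Field.absoluteGaloisGroup K) [Fact (κ.IsTopGenerator γ)]
      (𝔭 : HeightOneSpectrum (𝓞 K)), ((3 : ℕ) : 𝓞 K) ∈ 𝔭.asIdeal →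
    ∀ (𝔭' : HeightOneSpectrum (𝓞 K)), ((3 : ℕ) : 𝓞 K) ∈ 𝔭'.asIdeal → 𝔭' ≠ 𝔭 →
    ∀ (κ₁ κ₂ : ZpExtension K 3) (γ₁ γ₂ : Field.absoluteGaloisGroup K) (k : ℕ)
      [Fact (ZpExtension.IsTopGeneratorPair κ₁ κ₂ γ₁ γ₂)],
    (∀ v : HeightOneSpectrum (𝓞 K), v ≠ 𝔭 → ∀ 𝔓 ∈ v.primesAbove,
        𝔓.inertia (Field.absoluteGaloisGroup K) ≤ κ₁.kerSubgroup) →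
    ZpExtension.pairKer κ₁ κ₂ ≤ κ.kerSubgroup → γ₁ * γ⁻¹ ∈ κ.kerSubgroup → γ₂ * (γ ^ (3 ^ k))⁻¹ ∈ κ.kerSubgroup →
    Module.Finite (IwasawaAlgebra₂ 3) ((W.baseChange K).XGr₂ 3 κ₁ κ₂ 𝔭' γ₁ γ₂) →
    Module.IsTorsion (IwasawaAlgebra₂ 3) ((W.baseChange K).XGr₂ 3 κ₁ κ₂ 𝔭' γ₁ γ₂) →
    ∀ N : Submodule (IwasawaAlgebra₂ 3) ((W.baseChange K).XGr₂ 3 κ₁ κ₂ 𝔭' γ₁ γ₂),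
      Literature.NumberTheory.EllipticCurves.Module.IsPseudoNull (IwasawaAlgebra₂ 3) N → Finite N :=
  NoPseudoNullOfPoitouTate.stub_noPseudoNull_of_poitouTateAt
    Summit.BirchSwinnertonDyer.BirchSwinnertonDyer.Theorems.PoitouTateShaNaturalAtTC.forall_poitouTate_shaRestricted_tateDual_natural_at_of_isTotallyComplex

end Summit.BirchSwinnertonDyer.BirchSwinnertonDyer.Theorems.UniversalToricDescentThinComb.NoPseudoNull

end
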